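import Mathlib
import Summits.NavierStokesRegularity.NavierStokesRegularity.Theorems.EulerZoomLiouvillePowerGaugeEulerLiouvilleSelfSimilarSourceCapture
import Summits.NavierStokesRegularity.NavierStokesRegularity.Theorems.EulerZoomLiouvillePowerGaugeEulerLiouvilleSelfSimilarAlphaLimit
import Summits.NavierStokesRegularity.NavierStokesRegularity.Theorems.EulerZoomLiouvillePowerGaugeEulerLiouvilleSelfSimilarSourceSpiral
import Literature.Dynamics.FixedPoints.StableManifoldTheorem
import Literature.Dynamics.TopologicalDynamics.LimitSetFiniteConvergence
import Literature.Analysis.ODE.EvolutionMapAutonomous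
import HarnessLib

/-!
# Rung C1 of the crux `EulerZoomLiouville.PowerGaugeEulerLiouville`: an in-window classical self-similar profile
# whose similarity flow has FINITELY MANY stagnation points, each either VORTICITY-FREE NEARBY (sources) or
# HYPERBOLICALLY THIN (a contracting direction), is trivial — step (M) of the crux idea «hyperbolic-stagnation
# exclusion» (route №10, item stmt-NavierStokesRegularity-19832; `--supports`)

Helper file (theorems only). Seat ns-typeII-p3 (cell ns-regularity-ideate §B, D-0081).  This is the GLOBAL
composition step (M) of the crux idea *hyperbolic-stagnation exclusion* (tree
`Cruxes/PowerGaugeEulerLiouville/Ideas/hyperbolic-stagnation-exclusion.md`), assembling five tree pieces: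

* `…SelfSimilarAlphaLimit` (this seat, p540870): for `0 < γ < ½` every backward trajectory of the similarity flow
  `Φ_s` of `W = γy + V` is bounded and `W(Φ_s y) → 0` as `s → −∞`;
* `Literature.Dynamics.TopologicalDynamics.exists_tendsto_atBot_of_mapClusterPt_mem_finite` (typeII-lit-1, p548495;
  Robinson 1999 Ch. V Thm 4.1 (d)): a curve with precompact backward tail whose limit points lie in a finite set
  converges;
* `Literature.Dynamics.FixedPoints.Robinson1999_stableManifoldTheorem.addHaar_setOf_tendsto_atBot_eq_zero`
  (typeII-lit-1, p548097; the Stable Manifold Theorem, Robinson 1999 Ch. V Thm 10.1, as the NAMED FACT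
  `Robinson1999_stableManifoldTheorem`): along a one-parameter group with `C¹` time-one map, the set of points
  converging backward to an equilibrium whose time-one linearisation has a hyperbolic splitting with a CONTRACTING
  direction (`Eu ≠ ⊤`) is Lebesgue-null;
* `…SelfSimilarSourceCapture` (this seat, p545673): the zero set of `Ω = curl V` is flow-invariant, and capture of
  a dense set of points by the vorticity-free region forces `Ω ≡ 0`, then (far field, `V(0) = 0`) `V ≡ 0`;
* `…SelfSimilarSourceSpiral` (this seat, p547876): in the window `γ < ½`, `Ω ≡ 0` near every generic (block-form)
  source of `W`.

Contents:

* `flow_add`, `flow_eq_self_of_mem_nodalSet` — the similarity flow `Φ_s = ODE.evolutionMap (fun _ => W) 0 s` is a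
  one-parameter group (autonomous field: Teschl §2.4) fixing the stagnation points;
* `mem_nodalSet_of_mapClusterPt_atBot` — every backward limit point is a stagnation point (`W(Φ_s y) → 0`);
* `exists_tendsto_flow_atBot_of_finite` — **if the stagnation set `𝒩_W` is finite, EVERY backward trajectory
  CONVERGES to a stagnation point** (α-limit sets are connected);
* `volume_setOf_tendsto_flow_atBot_eq_zero` — the backward basin `{y : Φ_s y → z, s → −∞}` of a stagnation point
  `z` whose time-one linearisation `D(Φ_1)(z)` has a hyperbolic splitting with `Eu ≠ ⊤` is Lebesgue-null (Robinson);
* `exists_dense_capture_of_finite_nodalSet` — hence, if every stagnation point is either *fat* (`Ω ≡ 0` on a ball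
  around it) or *thin* (such a splitting), a DENSE set of points is captured by the vorticity-free region;
* **`curl_eq_zero_of_finite_nodalSet`, `eq_zero_of_finite_nodalSet`** — so `Ω ≡ 0`, and with the far field
  `DV → 0` and the CIV normalisation `V(0) = 0`, `V ≡ 0`;
* **`eq_zero_of_finiteHyperbolicStagnation`** — the idea card's theorem with the sources made explicit: every
  stagnation point is either a GENERIC SOURCE (`DW(z)` in real block normal form with positive diagonal rates — then
  `Ω ≡ 0` nearby by `curl_eq_zero_near_blockSource`, unconditionally in the window) or THIN ⇒ `V ≡ 0`.

All statements are CONDITIONAL on the cited named fact `(hSMT : Robinson1999_stableManifoldTheorem)` (Robinson 1999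
Ch. V Thm 10.1, finite-dimensional `C¹` form; typeII-lit-1's `Literature/Dynamics/FixedPoints/StableManifoldTheorem`).
The thinness hypothesis is stated at the level the fact consumes — a hyperbolic splitting of the derivative of the
TIME-ONE MAP `Φ_1` at the node (`= exp(DW(z))`; the spectral dictionary `spec DW(z) ↦ splitting of exp DW(z)` is the
sequel's business).  Refuter reading: a nontrivial in-window classical profile with the far field must have infinitely
many stagnation points, or a stagnation point that is neither a generic source nor hyperbolically thin (an eigenvalue
of `DW(z)` on the imaginary axis, or a defective repeated positive eigenvalue).

WHAT THIS IS NOT: not NS, not E, not rung C1 — the classical (`C^∞`, bounded-gradient) sub-case of the C1 residue with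
a finite, node-wise hyperbolic stagnation set, modulo the Robinson fact.
[folklore; cf. ConstantinIgnatovaVicol2026Putative §3.5 proof of Thm 3.10 (propagation from the nodal set);
Robinson1999 Ch. V Thm 4.1 (d), Thm 10.1, §5.10.3]
-/

noncomputable section

-- flat `Theorems/<Route><Decl>…` files of one crux share the namespace of the crux (tree convention)
set_option linter.dupNamespace false

open MeasureTheory Set Filter Topology Metric Function InnerProductSpace
open scoped RealInnerProductSpace NNReal ContDiff

namespace Summit.NavierStokesRegularity.NavierStokesRegularity.Theorems.PowerGaugeEulerLiouville.Kelvin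

open Literature.Analysis Literature.Analysis.FluidPDE Literature.Dynamics.FixedPoints
  Literature.Dynamics.TopologicalDynamics

variable {γ : ℝ} {V : EuclideanSpace ℝ (Fin 3) → EuclideanSpace ℝ (Fin 3)} {P : EuclideanSpace ℝ (Fin 3) → ℝ}

/-! ### The similarity flow is a one-parameter group fixing the stagnation points -/

/-- `W = γy + V` is globally Lipschitz with constant `|γ| + K` when `‖DV‖ ≤ K`. [folklore] -/
theorem lipschitzWith_selfSimilarTransport (hV : ContDiff ℝ ∞ V) {K : ℝ} (hK : ∀ y, ‖fderiv ℝ V y‖ ≤ K) :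
    LipschitzWith (Real.toNNReal (|γ| + K)) (selfSimilarTransport γ 0 V) := by
  have hVd : Differentiable ℝ V := hV.differentiable (by simp)
  refine lipschitzWith_of_nnnorm_fderiv_le
    ((contDiff_selfSimilarTransport (γ := γ) hV).differentiable (by simp)) fun y => ?_
  have h := norm_fderiv_selfSimilarTransport_le (γ := γ) hVd hK y
  rw [← norm_toNNReal]
  exact Real.toNNReal_le_toNNReal h

/-- **Group law of the similarity flow**: `Φ_{s+t} = Φ_s ∘ Φ_t` (autonomous field `W`; Teschl §2.4
`φ(t, t₀, x) = φ(t − t₀, 0, x)` + the process property). [folklore] -/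
theorem flow_add (hV : ContDiff ℝ ∞ V) {K : ℝ} (hK : ∀ y, ‖fderiv ℝ V y‖ ≤ K)
    (s t : ℝ) (y : EuclideanSpace ℝ (Fin 3)) :
    ODE.evolutionMap (fun _ : ℝ => selfSimilarTransport γ 0 V) 0 (s + t) y =
      ODE.evolutionMap (fun _ : ℝ => selfSimilarTransport γ 0 V) 0 s
        (ODE.evolutionMap (fun _ : ℝ => selfSimilarTransport γ 0 V) 0 t y) := by
  have hL := isUniformlyLipschitzOn_transport (γ := γ) hV hK
  have h1 := ODE.evolutionMap_const_eq_evolutionMap_zero (lipschitzWith_selfSimilarTransport (γ := γ) hV hK)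
    t (t + s) (ODE.evolutionMap (fun _ : ℝ => selfSimilarTransport γ 0 V) 0 t y)
  rw [add_sub_cancel_left] at h1
  rw [← h1, hL.evolutionMap_trans convex_univ (mem_univ _) (mem_univ _) (mem_univ _), add_comm]

/-- `Φ_0 = id`. [folklore] -/
theorem flow_zero (y : EuclideanSpace ℝ (Fin 3)) :
    ODE.evolutionMap (fun _ : ℝ => selfSimilarTransport γ 0 V) 0 0 y = y :=
  ODE.evolutionMap_self _ 0 y

/-- **Stagnation points are rest points of the flow**: `Φ_s z = z` for `z ∈ 𝒩_W`. [folklore] -/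
theorem flow_eq_self_of_mem_nodalSet (hV : ContDiff ℝ ∞ V) {K : ℝ} (hK : ∀ y, ‖fderiv ℝ V y‖ ≤ K)
    {z : EuclideanSpace ℝ (Fin 3)} (hz : z ∈ selfSimilarNodalSet γ 0 V) (s : ℝ) :
    ODE.evolutionMap (fun _ : ℝ => selfSimilarTransport γ 0 V) 0 s z = z :=
  (isUniformlyLipschitzOn_transport (γ := γ) hV hK).evolutionMap_eq_self_of_forall_eq_zero convex_univ
    (fun _ _ => hz) (mem_univ _) (mem_univ _)

/-- Trajectories `s ↦ Φ_s y` are continuous. [folklore] -/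
theorem continuous_flow_apply (hV : ContDiff ℝ ∞ V) {K : ℝ} (hK : ∀ y, ‖fderiv ℝ V y‖ ≤ K)
    (y : EuclideanSpace ℝ (Fin 3)) :
    Continuous fun s => ODE.evolutionMap (fun _ : ℝ => selfSimilarTransport γ 0 V) 0 s y :=
  continuous_iff_continuousAt.2 fun s => (hasDerivAt_flow (γ := γ) hV hK s y).continuousAt

/-! ### Backward limit points are stagnation points; finitely many ⇒ convergence -/

/-- **Every backward limit point is a stagnation point** (`0 < γ < ½`): if `z` is a cluster point of `Φ_s y`
as `s → −∞` then `W(z) = 0`, because `W(Φ_s y) → 0` (`tendsto_transport_flow_atBot`) and `W` is continuous.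
[cite: ConstantinIgnatovaVicol2026Putative, §3.4.3 eq. (3.33)] -/
theorem mem_nodalSet_of_mapClusterPt_atBot (hV : ContDiff ℝ ∞ V) {K : ℝ} (hK : ∀ y, ‖fderiv ℝ V y‖ ≤ K)
    (hprof : IsSelfSimilarEulerProfile γ 0 V P) {M P₀ : ℝ} (hM : ∀ y, ‖V y‖ ≤ M) (hP : ∀ y, P y ≤ P₀)
    (hγ : 0 < γ) (hγ2 : γ < 1 / 2) {y z : EuclideanSpace ℝ (Fin 3)}
    (hz : MapClusterPt z atBot fun s => ODE.evolutionMap (fun _ : ℝ => selfSimilarTransport γ 0 V) 0 s y) :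
    z ∈ selfSimilarNodalSet γ 0 V := by
  have hWc : Continuous (selfSimilarTransport γ 0 V) :=
    (contDiff_selfSimilarTransport (γ := γ) hV).continuous
  have h1 : MapClusterPt (selfSimilarTransport γ 0 V z) atBot
      (selfSimilarTransport γ 0 V ∘ fun s => ODE.evolutionMap (fun _ : ℝ => selfSimilarTransport γ 0 V) 0 s y) :=
    hz.continuousAt_comp hWc.continuousAt
  have h2 := tendsto_transport_flow_atBot hV hK hprof hM hP hγ hγ2 y
  have h3 : ClusterPt (selfSimilarTransport γ 0 V z) (𝓝 0) := h1.clusterPt.mono h2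
  exact eq_of_nhds_neBot h3

/-- **Finitely many stagnation points ⇒ every backward trajectory converges to one of them** (`0 < γ < ½`):
backward trajectories are bounded (`norm_flow_le_of_nonpos`), their limit points are stagnation points, and the
α-limit set of a bounded backward semi-orbit is connected (Robinson Ch. V Thm 4.1 (d)), hence a single point of
the finite set `𝒩_W`. [cite: Robinson1999, Ch. V Thm 4.1 (d)] -/
theorem exists_tendsto_flow_atBot_of_finite (hV : ContDiff ℝ ∞ V) {K : ℝ} (hK : ∀ y, ‖fderiv ℝ V y‖ ≤ K)
    (hprof : IsSelfSimilarEulerProfile γ 0 V P) {M P₀ : ℝ} (hM : ∀ y, ‖V y‖ ≤ M) (hP : ∀ y, P y ≤ P₀)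
    (hγ : 0 < γ) (hγ2 : γ < 1 / 2) (hfin : (selfSimilarNodalSet γ 0 V).Finite)
    (y : EuclideanSpace ℝ (Fin 3)) :
    ∃ z ∈ selfSimilarNodalSet γ 0 V,
      Tendsto (fun s => ODE.evolutionMap (fun _ : ℝ => selfSimilarTransport γ 0 V) 0 s y) atBot (𝓝 z) := by
  set B : ℝ := max 1 ((γ * M + |1 / 2 * M ^ 2 + P₀| + |selfSimilarBernoulli γ 0 V P y| + 1) / (γ * (1 / 2 - γ)))
    with hB
  have hK' : IsCompact (closedBall (0 : EuclideanSpace ℝ (Fin 3)) B) := isCompact_closedBall 0 B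
  have htail : ∀ᶠ s in atBot,
      ODE.evolutionMap (fun _ : ℝ => selfSimilarTransport γ 0 V) 0 s y ∈ closedBall (0 : EuclideanSpace ℝ (Fin 3)) B := by
    filter_upwards [eventually_le_atBot (0 : ℝ)] with s hs
    rw [mem_closedBall, dist_zero_right, hB]
    exact norm_flow_le_of_nonpos hV hK hprof hM hP hγ hγ2 y hs
  exact exists_tendsto_atBot_of_mapClusterPt_mem_finite (continuous_flow_apply (γ := γ) hV hK y) hK' htail hfin
    fun z hz => mem_nodalSet_of_mapClusterPt_atBot hV hK hprof hM hP hγ hγ2 hz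

/-! ### The backward basin of a hyperbolically thin stagnation point is Lebesgue-null -/

/-- **The backward basin of a thin stagnation point is null** (Stable Manifold Theorem, Robinson Ch. V Thm 10.1 via
the time-one map, §5.10.3): if `z ∈ 𝒩_W` and the derivative of the time-one map `Φ_1` at `z` admits a hyperbolic
splitting `Es ⊕ Eu` with `Eu ≠ ⊤` (a contracting direction), then `{y : Φ_s y → z as s → −∞}` has Lebesgue measure
zero.  Conditional on the named fact `Robinson1999_stableManifoldTheorem`. [cite: Robinson1999, Ch. V Thm 10.1 and §5.10.3] -/
theorem volume_setOf_tendsto_flow_atBot_eq_zero (hSMT : Robinson1999_stableManifoldTheorem.{0})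
    (hV : ContDiff ℝ ∞ V) {K : ℝ} (hK : ∀ y, ‖fderiv ℝ V y‖ ≤ K)
    {z : EuclideanSpace ℝ (Fin 3)} (hz : z ∈ selfSimilarNodalSet γ 0 V)
    {Es Eu : Submodule ℝ (EuclideanSpace ℝ (Fin 3))}
    (hL : IsHyperbolicSplitting
      (fderiv ℝ (ODE.evolutionMap (fun _ : ℝ => selfSimilarTransport γ 0 V) 0 1) z) Es Eu)
    (hEu : Eu ≠ ⊤) :
    volume {y : EuclideanSpace ℝ (Fin 3) |
      Tendsto (fun s => ODE.evolutionMap (fun _ : ℝ => selfSimilarTransport γ 0 V) 0 s y) atBot (𝓝 z)} = 0 :=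
  hSMT.addHaar_setOf_tendsto_atBot_eq_zero volume (Φ := ODE.evolutionMap (fun _ : ℝ => selfSimilarTransport γ 0 V) 0)
    flow_zero (flow_add (γ := γ) hV hK) ((contDiff_flow (γ := γ) hV hK 1).of_le (by norm_cast))
    (flow_eq_self_of_mem_nodalSet hV hK hz 1) hL hEu

/-! ### Dense capture from a finite fat-or-thin stagnation set -/

/-- **Dense capture.**  Let `(V, P)` be a classical in-window profile (`0 < γ < ½`, `V` smooth and bounded with
`‖DV‖ ≤ K`, `P` bounded above) whose stagnation set `𝒩_W` is FINITE, and suppose every `z ∈ 𝒩_W` is either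
FAT — `curl V ≡ 0` on a ball around `z` — or THIN — `D(Φ_1)(z)` has a hyperbolic splitting with a contracting
direction.  Then a dense set of points `y` is captured by the vorticity-free region: `curl V (Φ_s y) = 0` for some
`s`.  (Every `y` converges backward to some node; the basins of the thin nodes are null, so off a null — hence
nowhere dense — set the limit node is fat and the trajectory enters its vorticity-free ball.)
[cite: Robinson1999, Ch. V Thm 10.1 and Thm 4.1 (d)] -/
theorem exists_dense_capture_of_finite_nodalSet (hSMT : Robinson1999_stableManifoldTheorem.{0})
    (hV : ContDiff ℝ ∞ V) {K : ℝ} (hK : ∀ y, ‖fderiv ℝ V y‖ ≤ K)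
    (hprof : IsSelfSimilarEulerProfile γ 0 V P) {M P₀ : ℝ} (hM : ∀ y, ‖V y‖ ≤ M) (hP : ∀ y, P y ≤ P₀)
    (hγ : 0 < γ) (hγ2 : γ < 1 / 2) (hfin : (selfSimilarNodalSet γ 0 V).Finite)
    (hnodes : ∀ z ∈ selfSimilarNodalSet γ 0 V,
      (∃ r : ℝ, 0 < r ∧ ∀ y : EuclideanSpace ℝ (Fin 3), ‖y - z‖ < r → curl V y = 0) ∨
      (∃ Es Eu : Submodule ℝ (EuclideanSpace ℝ (Fin 3)),
        IsHyperbolicSplitting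
          (fderiv ℝ (ODE.evolutionMap (fun _ : ℝ => selfSimilarTransport γ 0 V) 0 1) z) Es Eu ∧ Eu ≠ ⊤)) :
    ∃ D : Set (EuclideanSpace ℝ (Fin 3)), Dense D ∧
      ∀ y ∈ D, ∃ s : ℝ, curl V (ODE.evolutionMap (fun _ : ℝ => selfSimilarTransport γ 0 V) 0 s y) = 0 := by
  set Φ := ODE.evolutionMap (fun _ : ℝ => selfSimilarTransport γ 0 V) 0 with hΦ
  -- the thin-but-not-fat nodes and their (null) backward basins
  set T : Set (EuclideanSpace ℝ (Fin 3)) := {z | z ∈ selfSimilarNodalSet γ 0 V ∧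
    ¬ (∃ r : ℝ, 0 < r ∧ ∀ y : EuclideanSpace ℝ (Fin 3), ‖y - z‖ < r → curl V y = 0)} with hT
  have hTfin : T.Finite := hfin.subset fun z hz => hz.1
  have hnull : volume (⋃ z ∈ T, {y : EuclideanSpace ℝ (Fin 3) | Tendsto (fun s => Φ s y) atBot (𝓝 z)}) = 0 := by
    refine (measure_biUnion_null_iff hTfin.countable).2 fun z hz => ?_
    rcases hnodes z hz.1 with hfat | ⟨Es, Eu, hL, hEu⟩
    · exact absurd hfat hz.2
    · exact volume_setOf_tendsto_flow_atBot_eq_zero hSMT hV hK hz.1 hL hEu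
  have hae : ∀ᵐ y : EuclideanSpace ℝ (Fin 3) ∂volume,
      y ∉ ⋃ z ∈ T, {y : EuclideanSpace ℝ (Fin 3) | Tendsto (fun s => Φ s y) atBot (𝓝 z)} :=
    measure_eq_zero_iff_ae_notMem.1 hnull
  refine ⟨{y | y ∉ ⋃ z ∈ T, {y : EuclideanSpace ℝ (Fin 3) | Tendsto (fun s => Φ s y) atBot (𝓝 z)}},
    Measure.dense_of_ae hae, fun y hy => ?_⟩
  obtain ⟨z, hzN, hz⟩ := exists_tendsto_flow_atBot_of_finite hV hK hprof hM hP hγ hγ2 hfin y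
  -- the limit node of `y` is fat
  have hfat : ∃ r : ℝ, 0 < r ∧ ∀ w : EuclideanSpace ℝ (Fin 3), ‖w - z‖ < r → curl V w = 0 := by
    by_contra hcon
    exact hy (mem_biUnion (show z ∈ T from ⟨hzN, hcon⟩) hz)
  obtain ⟨r, hr, hball⟩ := hfat
  have hev : ∀ᶠ s in atBot, ‖Φ s y - z‖ < r := by
    have h := hz.eventually (ball_mem_nhds z hr)
    exact h.mono fun s hs => by rwa [← dist_eq_norm]
  obtain ⟨s, hs⟩ := hev.exists
  exact ⟨s, hball _ hs⟩

/-! ### The theorem: finite fat-or-thin stagnation set ⇒ trivial profile -/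

/-- **Irrotational.**  Under the hypotheses of `exists_dense_capture_of_finite_nodalSet`, `curl V ≡ 0`
(dense capture + flow-invariance of the vorticity zero set, `curl_eq_zero_of_dense_capture`).
[cite: ConstantinIgnatovaVicol2026Putative, §3.5 proof of Thm 3.10 (propagation step)] -/
theorem curl_eq_zero_of_finite_nodalSet (hSMT : Robinson1999_stableManifoldTheorem.{0})
    (hV : ContDiff ℝ ∞ V) {K : ℝ} (hK : ∀ y, ‖fderiv ℝ V y‖ ≤ K)
    (hprof : IsSelfSimilarEulerProfile γ 0 V P) {M P₀ : ℝ} (hM : ∀ y, ‖V y‖ ≤ M) (hP : ∀ y, P y ≤ P₀)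
    (hγ : 0 < γ) (hγ2 : γ < 1 / 2) (hfin : (selfSimilarNodalSet γ 0 V).Finite)
    (hnodes : ∀ z ∈ selfSimilarNodalSet γ 0 V,
      (∃ r : ℝ, 0 < r ∧ ∀ y : EuclideanSpace ℝ (Fin 3), ‖y - z‖ < r → curl V y = 0) ∨
      (∃ Es Eu : Submodule ℝ (EuclideanSpace ℝ (Fin 3)),
        IsHyperbolicSplitting
          (fderiv ℝ (ODE.evolutionMap (fun _ : ℝ => selfSimilarTransport γ 0 V) 0 1) z) Es Eu ∧ Eu ≠ ⊤)) :
    ∀ y, curl V y = 0 := by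
  obtain ⟨D, hD, hcap⟩ := exists_dense_capture_of_finite_nodalSet hSMT hV hK hprof hM hP hγ hγ2 hfin hnodes
  exact curl_eq_zero_of_dense_capture hV hK hprof hD hcap

/-- **THE STEP (M) THEOREM — finite fat-or-thin stagnation set ⇒ trivial profile.**  Let `(V, P)` be a classical
self-similar Euler profile (`IsSelfSimilarEulerProfile γ 0 V P`, `V` smooth and bounded, `‖DV‖ ≤ K`, `P` bounded
above) in the window `0 < γ < ½`, with the far field `DV → 0` at infinity and the CIV normalisation `V(0) = 0`.
If the stagnation set of `W = γy + V` is FINITE and every stagnation point is either fat (`curl V ≡ 0` on a ball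
around it) or thin (`D(Φ_1)(z)` has a hyperbolic splitting with a contracting direction), then `V ≡ 0`.
Conditional on the named fact `Robinson1999_stableManifoldTheorem`.
[cite: Robinson1999, Ch. V Thm 10.1; ConstantinIgnatovaVicol2026Putative, §3.5 Thm 3.10 (proof, propagation step)] -/
theorem eq_zero_of_finite_nodalSet (hSMT : Robinson1999_stableManifoldTheorem.{0})
    (hV : ContDiff ℝ ∞ V) {K : ℝ} (hK : ∀ y, ‖fderiv ℝ V y‖ ≤ K)
    (hprof : IsSelfSimilarEulerProfile γ 0 V P) {M P₀ : ℝ} (hM : ∀ y, ‖V y‖ ≤ M) (hP : ∀ y, P y ≤ P₀)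
    (hγ : 0 < γ) (hγ2 : γ < 1 / 2) (hfin : (selfSimilarNodalSet γ 0 V).Finite)
    (hnodes : ∀ z ∈ selfSimilarNodalSet γ 0 V,
      (∃ r : ℝ, 0 < r ∧ ∀ y : EuclideanSpace ℝ (Fin 3), ‖y - z‖ < r → curl V y = 0) ∨
      (∃ Es Eu : Submodule ℝ (EuclideanSpace ℝ (Fin 3)),
        IsHyperbolicSplitting
          (fderiv ℝ (ODE.evolutionMap (fun _ : ℝ => selfSimilarTransport γ 0 V) 0 1) z) Es Eu ∧ Eu ≠ ⊤))
    (hfar : Tendsto (fun y => ‖fderiv ℝ V y‖) (cocompact (EuclideanSpace ℝ (Fin 3))) (𝓝 0)) (h0 : V 0 = 0) :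
    V = 0 := by
  obtain ⟨D, hD, hcap⟩ := exists_dense_capture_of_finite_nodalSet hSMT hV hK hprof hM hP hγ hγ2 hfin hnodes
  exact eq_zero_of_dense_capture hV hK hprof hD hcap hfar h0

/-! ### The idea card's theorem: generic sources are fat (window), the other nodes thin ⇒ trivial -/

/-- **HYPERBOLIC-STAGNATION EXCLUSION (generic sources, thin remainder).**  Let `(V, P)` be a classical self-similar
Euler profile in the window `0 < γ < ½` (`V` smooth and bounded, `‖DV‖ ≤ K`, `P` bounded above, far field
`DV → 0`, `V(0) = 0`) whose similarity field `W = γy + V` has FINITELY MANY stagnation points, each of which is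
EITHER a generic source — `DW(z) = γI + DV(z)` has the real normal form `A b₀ = d₀b₀ − βb₁`, `A b₁ = βb₀ + d₁b₁`,
`A b₂ = d₂b₂` in some basis with `dᵢ > 0` (nodal or spiral source; then `curl V ≡ 0` near `z` by
`curl_eq_zero_near_blockSource`, since `Σdᵢ = 3γ < 1 + γ`) — OR thin (the time-one map's derivative `D(Φ_1)(z)` has
a hyperbolic splitting with a contracting direction, so its backward basin is null by the Stable Manifold Theorem).
Then `V ≡ 0`.  Conditional on the named fact `Robinson1999_stableManifoldTheorem`; the refuting classical profiles
of rung C1 must therefore carry infinitely many stagnation points or a stagnation point that is neither.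
[cite: ConstantinIgnatovaVicol2026Putative, §3.5 Thms 3.8/3.10 (strengthened: spectral sources, no analyticity, saddles allowed); Robinson1999, Ch. V Thm 10.1] -/
theorem eq_zero_of_finiteHyperbolicStagnation (hSMT : Robinson1999_stableManifoldTheorem.{0})
    (hV : ContDiff ℝ ∞ V) {K : ℝ} (hK : ∀ y, ‖fderiv ℝ V y‖ ≤ K)
    (hprof : IsSelfSimilarEulerProfile γ 0 V P) {M P₀ : ℝ} (hM : ∀ y, ‖V y‖ ≤ M) (hP : ∀ y, P y ≤ P₀)
    (hγ : 0 < γ) (hγ2 : γ < 1 / 2) (hfin : (selfSimilarNodalSet γ 0 V).Finite)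
    (hnodes : ∀ z ∈ selfSimilarNodalSet γ 0 V,
      (∃ (b : Module.Basis (Fin 3) ℝ (EuclideanSpace ℝ (Fin 3))) (lam : Fin 3 → ℝ) (β : ℝ),
        (γ • ContinuousLinearMap.id ℝ (EuclideanSpace ℝ (Fin 3)) + fderiv ℝ V z) (b 0) = lam 0 • b 0 - β • b 1 ∧
        (γ • ContinuousLinearMap.id ℝ (EuclideanSpace ℝ (Fin 3)) + fderiv ℝ V z) (b 1) = β • b 0 + lam 1 • b 1 ∧
        (γ • ContinuousLinearMap.id ℝ (EuclideanSpace ℝ (Fin 3)) + fderiv ℝ V z) (b 2) = lam 2 • b 2 ∧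
        ∀ i, 0 < lam i) ∨
      (∃ Es Eu : Submodule ℝ (EuclideanSpace ℝ (Fin 3)),
        IsHyperbolicSplitting
          (fderiv ℝ (ODE.evolutionMap (fun _ : ℝ => selfSimilarTransport γ 0 V) 0 1) z) Es Eu ∧ Eu ≠ ⊤))
    (hfar : Tendsto (fun y => ‖fderiv ℝ V y‖) (cocompact (EuclideanSpace ℝ (Fin 3))) (𝓝 0)) (h0 : V 0 = 0) :
    V = 0 := by
  refine eq_zero_of_finite_nodalSet hSMT hV hK hprof hM hP hγ hγ2 hfin (fun z hz => ?_) hfar h0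
  rcases hnodes z hz with ⟨b, lam, β, hA0, hA1, hA2, hpos⟩ | hthin
  · exact Or.inl (curl_eq_zero_near_blockSource hV hK hprof hγ2 hz b lam β hA0 hA1 hA2 hpos)
  · exact Or.inr hthin

end Summit.NavierStokesRegularity.NavierStokesRegularity.Theorems.PowerGaugeEulerLiouville.Kelvin

end
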